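import Summits.AtomisticToContinuum.Crystallization.Theses.ChessboardParticlePlanes
import Summits.AtomisticToContinuum.Crystallization.Theorems.ChessboardParticlePlanesPeriodicWindowsRotHull
import Summits.AtomisticToContinuum.Crystallization.Theorems.ChessboardParticlePlanesPeriodicWindowsStubCleanLimit
import Summits.AtomisticToContinuum.Crystallization.Theorems.ChessboardParticlePlanesPeriodicWindowsStubHcpWindowsLimit
import Summits.AtomisticToContinuum.Crystallization.Theorems.GscTwinLoopSurgeryLocalLimitStable
import Summits.AtomisticToContinuum.Crystallization.Theorems.HullExactificationCascadeHullBulkOptimal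
import Literature.MathematicalPhysics.StatisticalMechanics.LocalLimitOfGroundStates
import Literature.MathematicalPhysics.StatisticalMechanics.HardCoreGSC
import Literature.MathematicalPhysics.StatisticalMechanics.BarlowStacking

/-!
# Crux `PeriodicWindows` (stmt-AtomisticToContinuum-3240), line `Sketch` — rotated-hull glue G1–G3

Helpers for the lead skeleton `PeriodicWindowsSketch` (rev 7, route `ChessboardParticlePlanes`), all about points of
the ROTATED HULL of a Lennard-Jones ground-state sequence `x` (`∃ σ τ A, StrictMono σ ∧ ∀ R ε > 0, ∀ᶠ j,
BallMatch ε R 0 (range (A j ∘ x (σ j) + τ j)) X`):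

* G1 `rotHull_energetics` — a rotated-hull point is a hard-core canonical GSC (`LocalLimitStable`, item 14086) and
  bulk-optimal in the form of `HullBulkOptimal` (item 12090), run for the rotated ground states;
* G2 `exists_mirrorClosed_hullPoint` — clean balls of every size (conclusion of the lever) give, through the landed
  `stub_cleanLimit`, a dense laminar separated rotated-hull point that is EXACTLY mirror-closed;
* G3 `exists_hcp_hullPoint` — hcp windows of every size (conclusion of the planar stub) give, through the landed
  `stub_hcpWindowsLimit`, an exact `hcpStacking a₀ h₀` in the rotated hull.
-/

noncomputable section

namespace Summit.AtomisticToContinuum.Crystallization.Theorems.PeriodicWindowsSketch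

open Literature.MathematicalPhysics.StatisticalMechanics Filter Metric

/-! ## Glue G1 (proved): rotated-hull points are hard-core GSC and bulk-optimal -/

/-- **G1 (proved): energetics of the rotated hull.** Every point `X` of the rotated hull of a
Lennard-Jones ground-state sequence is a hard-core canonical GSC (`localLimitStable`:
`LocalLimitStable.isHardCoreGSC_of_isLocalLimitOfGroundStates` with
`rotHull_isLocalLimitOfGroundStates`) and BULK-OPTIMAL in the form of item `HullBulkOptimal`
(12090, PROVED: `HullBulkOptimal.sum_site_le_of_matched`, run for the rotated ground states
`A (σ⁻¹ N) ∘ x N`, which are ground states by `isGroundState_comp_isometry_iff`). -/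
theorem rotHull_energetics {x : (N : ℕ) → (Fin N → EuclideanSpace ℝ (Fin 3))}
    (hx : ∀ N, IsGroundState lennardJones (x N)) {X : Set (EuclideanSpace ℝ (Fin 3))}
    (hX : ∃ (σ : ℕ → ℕ) (τ : ℕ → EuclideanSpace ℝ (Fin 3))
        (A : ℕ → (EuclideanSpace ℝ (Fin 3) ≃ₗᵢ[ℝ] EuclideanSpace ℝ (Fin 3))),
      StrictMono σ ∧ ∀ R ε : ℝ, 0 < ε → ∀ᶠ j in Filter.atTop,
        BallMatch ε R 0 (Set.range fun i => A j (x (σ j) i) + τ j) X) :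
    IsHardCoreGSC lennardJones X ∧
    ∀ ε : ℝ, 0 < ε → ∃ L₀ : ℝ, ∀ L : ℝ, L₀ ≤ L → ∀ c : EuclideanSpace ℝ (Fin 3),
      (∑' y : ↥{y : EuclideanSpace ℝ (Fin 3) | y ∈ X ∧ dist y c ≤ L},
        (∑' z : ↥{z : EuclideanSpace ℝ (Fin 3) | z ∈ X ∧ z ≠ (y : EuclideanSpace ℝ (Fin 3))},
          lennardJones (dist (y : EuclideanSpace ℝ (Fin 3)) (z : EuclideanSpace ℝ (Fin 3))))) ≤
      2 * (Filter.liminf (fun N : ℕ => groundStateEnergy lennardJones 3 N / (N : ℝ)) Filter.atTop) *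
        (({y : EuclideanSpace ℝ (Fin 3) | y ∈ X ∧ dist y c ≤ L} : Set (EuclideanSpace ℝ (Fin 3))).ncard : ℝ) +
      ε * L ^ 3 := by
  classical
  refine ⟨LocalLimitStable.isHardCoreGSC_of_isLocalLimitOfGroundStates
    (rotHull_isLocalLimitOfGroundStates hx hX), fun ε hε => ?_⟩
  obtain ⟨σ, τ, A, hσ, hlim⟩ := hX
  -- the rotated ground states
  set x' : (N : ℕ) → (Fin N → EuclideanSpace ℝ (Fin 3)) :=
    fun N i => A (Function.invFun σ N) (x N i) with hx'def
  have hx' : ∀ N, IsGroundState lennardJones (x' N) := fun N =>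
    (isGroundState_comp_isometry_iff lennardJones
      (A (Function.invFun σ N)).isometry (x := x N)).2 (hx N)
  have hlim' : ∀ R ε : ℝ, 0 < ε → ∀ᶠ j : ℕ in atTop,
      (∀ s ∈ X, ‖s‖ ≤ R → ∃ i : Fin (σ j), dist (x' (σ j) i + τ j) s ≤ ε) ∧
      (∀ i : Fin (σ j), ‖x' (σ j) i + τ j‖ ≤ R → ∃ s ∈ X, dist (x' (σ j) i + τ j) s ≤ ε) := by
    intro R ε' hε'
    filter_upwards [hlim R ε' hε'] with j hj
    have hinv : Function.invFun σ (σ j) = j := Function.leftInverse_invFun hσ.injective j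
    have hj' : BallMatch ε' R 0 (Set.range fun i => x' (σ j) i + τ j) X := by
      simp only [hx'def, hinv]
      exact hj
    exact (ballMatch_zero_range_iff _ _ _).1 hj'
  exact HullBulkOptimal.sum_site_le_of_matched x' hx' hlim' hε

/-! ## Glue G2 (proved): clean balls ⇒ an exactly mirror-closed point of the rotated hull -/

/-- `BallMatch` is covariant under distance-preserving maps. -/
private theorem ballMatch_image_isometry {δ R : ℝ} {c : EuclideanSpace ℝ (Fin 3)}
    {A S : Set (EuclideanSpace ℝ (Fin 3))}
    (f : EuclideanSpace ℝ (Fin 3) → EuclideanSpace ℝ (Fin 3))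
    (hf : ∀ a b, dist (f a) (f b) = dist a b) (h : BallMatch δ R c A S) :
    BallMatch δ R (f c) (f '' A) (f '' S) := by
  refine ⟨?_, ?_⟩
  · rintro _ ⟨s, hs, rfl⟩ hsR
    rw [hf] at hsR
    obtain ⟨a, ha, has⟩ := h.1 s hs hsR
    exact ⟨f a, ⟨a, ha, rfl⟩, by rw [hf]; exact has⟩
  · rintro _ ⟨a, ha, rfl⟩ haR
    rw [hf] at haR
    obtain ⟨s, hs, has⟩ := h.2 a ha haR
    exact ⟨f s, ⟨s, hs, rfl⟩, by rw [hf]; exact has⟩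

/-- Mirror through a particle plane commutes with translations. -/
private theorem mirror_sub_const (p q c : EuclideanSpace ℝ (Fin 3)) :
    (q - c) - (2 * ((q - c) 2 - (p - c) 2)) • EuclideanSpace.single (2 : Fin 3) (1 : ℝ) =
      (q - (2 * (q 2 - p 2)) • EuclideanSpace.single (2 : Fin 3) (1 : ℝ)) - c := by
  have : (q - c) 2 - (p - c) 2 = q 2 - p 2 := by simp only [PiLp.sub_apply]; ring
  rw [this]
  abel

/-- The mirror image of a translate is the translate of the mirror image. -/
private theorem mirror_image_sub_const (X : Set (EuclideanSpace ℝ (Fin 3)))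
    (p c : EuclideanSpace ℝ (Fin 3)) :
    (fun q => q - (2 * (q 2 - (p - c) 2)) • EuclideanSpace.single (2 : Fin 3) (1 : ℝ)) ''
        ((fun q => q - c) '' X) =
      (fun q => q - c) ''
        ((fun q => q - (2 * (q 2 - p 2)) • EuclideanSpace.single (2 : Fin 3) (1 : ℝ)) '' X) := by
  simp only [Set.image_image]
  congr 1
  funext q
  exact mirror_sub_const p q c

/-- **G2 (proved): from clean balls to an exactly mirror-closed hull point.** If a dense, laminar,
separated point `X` of the rotated hull has clean balls of every size (conclusion of S3a), then the
recentred sets `X - c_k` (clean at scale `k` about `0`) have, by `stub_cleanLimit`, a local limit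
`X'` which is again in the rotated hull (`rotHull_image`, `rotHull_of_eventually_ballMatch`),
`ρ₀`-dense, separated, laminar and EXACTLY mirror-symmetric through each of its particle planes. -/
theorem exists_mirrorClosed_hullPoint (x : (N : ℕ) → (Fin N → EuclideanSpace ℝ (Fin 3)))
    {X : Set (EuclideanSpace ℝ (Fin 3))}
    (hX : ∃ (σ : ℕ → ℕ) (τ : ℕ → EuclideanSpace ℝ (Fin 3))
        (A : ℕ → (EuclideanSpace ℝ (Fin 3) ≃ₗᵢ[ℝ] EuclideanSpace ℝ (Fin 3))),
      StrictMono σ ∧ ∀ R ε : ℝ, 0 < ε → ∀ᶠ j in Filter.atTop,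
        BallMatch ε R 0 (Set.range fun i => A j (x (σ j) i) + τ j) X)
    {ρ₀ : ℝ} (hdense : ∀ c : EuclideanSpace ℝ (Fin 3), ∃ p ∈ X, dist p c ≤ ρ₀)
    (hlam : ∀ p ∈ X, ∀ q ∈ X, p 2 ≠ q 2 → (3 : ℝ) / 4 ≤ |p 2 - q 2|)
    (hsep : ∀ p ∈ X, ∀ q ∈ X, p ≠ q → (7 : ℝ) / 10 ≤ dist p q)
    (hclean : ∀ r η ρ : ℝ, 0 < η → ∃ c : EuclideanSpace ℝ (Fin 3), ∀ p ∈ X, dist p c ≤ ρ →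
      BallMatch η r p X
        ((fun q => q - (2 * (q 2 - p 2)) • EuclideanSpace.single (2 : Fin 3) (1 : ℝ)) '' X)) :
    ∃ X' : Set (EuclideanSpace ℝ (Fin 3)),
      (∃ (σ : ℕ → ℕ) (τ : ℕ → EuclideanSpace ℝ (Fin 3))
          (A : ℕ → (EuclideanSpace ℝ (Fin 3) ≃ₗᵢ[ℝ] EuclideanSpace ℝ (Fin 3))),
        StrictMono σ ∧ ∀ R ε : ℝ, 0 < ε → ∀ᶠ j in Filter.atTop,
          BallMatch ε R 0 (Set.range fun i => A j (x (σ j) i) + τ j) X') ∧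
      (∀ c : EuclideanSpace ℝ (Fin 3), ∃ p ∈ X', dist p c ≤ ρ₀) ∧
      (∀ p ∈ X', ∀ q ∈ X', p ≠ q → (7 : ℝ) / 10 ≤ dist p q) ∧
      (∀ p ∈ X', ∀ q ∈ X', p 2 ≠ q 2 → (3 : ℝ) / 4 ≤ |p 2 - q 2|) ∧
      (∀ p ∈ X', ∀ q ∈ X',
        q - (2 * (q 2 - p 2)) • EuclideanSpace.single (2 : Fin 3) (1 : ℝ) ∈ X') := by
  classical
  -- centres of clean balls at scale `(r, η, ρ) = (k, 1/(k+1), k)`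
  choose c hc using fun k : ℕ => hclean (k : ℝ) (1 / ((k : ℝ) + 1)) (k : ℝ) (by positivity)
  set Xs : ℕ → Set (EuclideanSpace ℝ (Fin 3)) := fun k => (fun q => q - c k) '' X with hXs
  have hsepK : ∀ k, ∀ p ∈ Xs k, ∀ q ∈ Xs k, p ≠ q → (7 : ℝ) / 10 ≤ dist p q := by
    rintro k _ ⟨p, hp, rfl⟩ _ ⟨q, hq, rfl⟩ hne
    rw [dist_sub_right]
    exact hsep p hp q hq fun h => hne (by rw [h])
  have hlamK : ∀ k, ∀ p ∈ Xs k, ∀ q ∈ Xs k, p 2 ≠ q 2 → (3 : ℝ) / 4 ≤ |p 2 - q 2| := by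
    rintro k _ ⟨p, hp, rfl⟩ _ ⟨q, hq, rfl⟩ hne
    have e : (p - c k) 2 - (q - c k) 2 = p 2 - q 2 := by simp only [PiLp.sub_apply]; ring
    rw [e]
    refine hlam p hp q hq fun h => hne ?_
    simp only [PiLp.sub_apply, h]
  have hdenK : ∀ k, ∀ c' : EuclideanSpace ℝ (Fin 3), ∃ p ∈ Xs k, dist p c' ≤ ρ₀ := by
    intro k c'
    obtain ⟨p, hp, hpc⟩ := hdense (c' + c k)
    refine ⟨p - c k, ⟨p, hp, rfl⟩, ?_⟩
    have : dist (p - c k) c' = dist p (c' + c k) := by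
      rw [dist_eq_norm, dist_eq_norm]
      congr 1
      abel
    rw [this]
    exact hpc
  have hcleanK : ∀ k : ℕ, ∀ p ∈ Xs k, dist p 0 ≤ (k : ℝ) →
      BallMatch (1 / ((k : ℝ) + 1)) k p (Xs k)
        ((fun q => q - (2 * (q 2 - p 2)) • EuclideanSpace.single (2 : Fin 3) (1 : ℝ)) '' Xs k) := by
    rintro k _ ⟨q, hq, rfl⟩ hq0
    have hqc : dist q (c k) ≤ k := by rwa [dist_zero_right, ← dist_eq_norm] at hq0
    have h := ballMatch_image_isometry (fun y => y - c k) (fun a b => dist_sub_right a b (c k))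
      (hc k q hq hqc)
    rw [← mirror_image_sub_const X q (c k)] at h
    exact h
  obtain ⟨φ, X', hφ, hmatch, hden', hsep', hlam', hmirror'⟩ :=
    stub_cleanLimit Xs ρ₀ hsepK hlamK hdenK hcleanK
  -- every `Xs k` is in the rotated hull, hence so is the limit `X'`
  have hXsHull : ∀ k, ∃ (σ : ℕ → ℕ) (τ : ℕ → EuclideanSpace ℝ (Fin 3))
      (A : ℕ → (EuclideanSpace ℝ (Fin 3) ≃ₗᵢ[ℝ] EuclideanSpace ℝ (Fin 3))),
      StrictMono σ ∧ ∀ R ε : ℝ, 0 < ε → ∀ᶠ j in Filter.atTop,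
        BallMatch ε R 0 (Set.range fun i => A j (x (σ j) i) + τ j) (Xs k) := by
    intro k
    have himg : (fun p => (LinearIsometryEquiv.refl ℝ (EuclideanSpace ℝ (Fin 3))) p + -c k) '' X =
        Xs k := by
      simp only [hXs, LinearIsometryEquiv.coe_refl, id_eq, ← sub_eq_add_neg]
    rw [← himg]
    exact rotHull_image x hX _ _
  refine ⟨X', ?_, hden', hsep', hlam', hmirror'⟩
  exact rotHull_of_eventually_ballMatch x (Xs := fun k => Xs (φ k)) (fun k => hXsHull (φ k)) hmatch

/-! ## Glue G3 (proved): hcp windows ⇒ an exact hcp stacking in the rotated hull -/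

/-- **G3 (proved): from hcp windows to an exact hcp point of the rotated hull.** If a point `X'`
of the rotated hull has hcp windows of every size (conclusion of S4a), the pulled-back sets
`B_k⁻¹ (X' - c_k)` (matched with `hcpStacking (a k) (h k)` on the `k`-ball about `0`) converge
along a subsequence to ONE `hcpStacking a₀ h₀` (`stub_hcpWindowsLimit`), which is therefore in the
rotated hull (`rotHull_image`, `rotHull_of_eventually_ballMatch`). -/
theorem exists_hcp_hullPoint (x : (N : ℕ) → (Fin N → EuclideanSpace ℝ (Fin 3)))
    {X' : Set (EuclideanSpace ℝ (Fin 3))}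
    (hX' : ∃ (σ : ℕ → ℕ) (τ : ℕ → EuclideanSpace ℝ (Fin 3))
        (A : ℕ → (EuclideanSpace ℝ (Fin 3) ≃ₗᵢ[ℝ] EuclideanSpace ℝ (Fin 3))),
      StrictMono σ ∧ ∀ R ε : ℝ, 0 < ε → ∀ᶠ j in Filter.atTop,
        BallMatch ε R 0 (Set.range fun i => A j (x (σ j) i) + τ j) X')
    (hwin : ∀ R η : ℝ, 0 < η → ∃ (c : EuclideanSpace ℝ (Fin 3)) (a h : ℝ)
      (B : EuclideanSpace ℝ (Fin 3) ≃ₗᵢ[ℝ] EuclideanSpace ℝ (Fin 3)),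
      1 / 2 ≤ a ∧ a ≤ 2 ∧ 1 / 2 ≤ h ∧ h ≤ 2 ∧
        BallMatch η R c X' ((fun q => B q + c) '' hcpStacking a h)) :
    ∃ a₀ h₀ : ℝ, 1 / 2 ≤ a₀ ∧ 1 / 2 ≤ h₀ ∧
      ∃ (σ : ℕ → ℕ) (τ : ℕ → EuclideanSpace ℝ (Fin 3))
          (A : ℕ → (EuclideanSpace ℝ (Fin 3) ≃ₗᵢ[ℝ] EuclideanSpace ℝ (Fin 3))),
        StrictMono σ ∧ ∀ R ε : ℝ, 0 < ε → ∀ᶠ j in Filter.atTop,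
          BallMatch ε R 0 (Set.range fun i => A j (x (σ j) i) + τ j) (hcpStacking a₀ h₀) := by
  classical
  choose c a h B ha ha' hh hh' hBM using
    fun k : ℕ => hwin (k : ℝ) (1 / ((k : ℝ) + 1)) (by positivity)
  set Xs : ℕ → Set (EuclideanSpace ℝ (Fin 3)) := fun k => (fun q => (B k).symm (q - c k)) '' X'
    with hXs
  have hf : ∀ k, ∀ p q : EuclideanSpace ℝ (Fin 3),
      dist ((B k).symm (p - c k)) ((B k).symm (q - c k)) = dist p q := fun k p q => by
    rw [LinearIsometryEquiv.dist_map, dist_sub_right]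
  have hwinK : ∀ k : ℕ, BallMatch (1 / ((k : ℝ) + 1)) k 0 (Xs k) (hcpStacking (a k) (h k)) := by
    intro k
    have hmatch := ballMatch_image_isometry (fun q => (B k).symm (q - c k)) (hf k) (hBM k)
    have h0 : (B k).symm (c k - c k) = 0 := by simp
    have himg : (fun q => (B k).symm (q - c k)) '' ((fun q => B k q + c k) '' hcpStacking (a k) (h k)) =
        hcpStacking (a k) (h k) := by
      rw [Set.image_image]
      convert Set.image_id _ using 2
      funext q
      simp
    simp only [h0, himg] at hmatch
    exact hmatch
  obtain ⟨φ, a₀, h₀, hφ, ha₀, -, hh₀, -, hlim⟩ :=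
    stub_hcpWindowsLimit Xs a h (fun k => ⟨ha k, ha' k⟩) (fun k => ⟨hh k, hh' k⟩) hwinK
  have hXsHull : ∀ k, ∃ (σ : ℕ → ℕ) (τ : ℕ → EuclideanSpace ℝ (Fin 3))
      (A : ℕ → (EuclideanSpace ℝ (Fin 3) ≃ₗᵢ[ℝ] EuclideanSpace ℝ (Fin 3))),
      StrictMono σ ∧ ∀ R ε : ℝ, 0 < ε → ∀ᶠ j in Filter.atTop,
        BallMatch ε R 0 (Set.range fun i => A j (x (σ j) i) + τ j) (Xs k) := by
    intro k
    have himg : (fun p => (B k).symm p + (B k).symm (-c k)) '' X' = Xs k := by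
      simp only [hXs]
      congr 1
      funext q
      rw [map_sub, map_neg, sub_eq_add_neg]
    rw [← himg]
    exact rotHull_image x hX' _ _
  exact ⟨a₀, h₀, ha₀, hh₀,
    rotHull_of_eventually_ballMatch x (Xs := fun k => Xs (φ k)) (fun k => hXsHull (φ k)) hlim⟩

end Summit.AtomisticToContinuum.Crystallization.Theorems.PeriodicWindowsSketch

end
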